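import Summits.RiemannHypothesis.RiemannHypothesis.Theorems.IntegerScrewCensusDualCheck

/-!
# Route `IntegerScrew` — kernel checker for the census DUAL certificates (2): cells, Taylor models, the walk

Second (per-cell) part of the dual checker (`IntegerScrewCensusDualCheck`): for each cell `[4c, 4c+4]` of the frequency
axis (centre `t₀ = 4c+2`, half-width `h = 2`) the node values `ẑ_a ≈ e^{i t₀ x_a}` come from the fast trig rows
(`IntegerScrewCensusFastRows.rows` at the single atom `j = 500 t₀`); the signed bilinear Kronecker sums
`Σ_a x_a · Σ_{b<a} Ω_ab x_b` over the term packs give, slot by slot (balanced extraction), the integer Taylor coefficients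
`G_k ≈ 2^{104+E} D!·Σ_f A_f (h f̃)^k/k!·Re(ζ̂_f i^k)` of `Q_Z(t₀ + σ h) − C0` (`ζ_f = z_a z̄_b` for a pair, `z_a` for a node);
the model is re-expanded in `τ ∈ [0,1]` (`σ = 2τ − 1`) with nonnegative Horner coefficients, and an adaptive walk over
dyadic points `τ = m/2^R` certifies `Q_Z ≥ 0` on the cell from the test
`H − S0 + min(H′ − S1, 0)η + ½ min(H″ − S2, 0)η² − Λη³ ≥ 0` (slacks `S0, S1, S2` for the node-value, frequency and
truncation errors, `Λ` the third-derivative bound).  The checker `dualCheck` runs the cells `cFrom ≤ c < cTo`; the light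
test `dualLight` does the exact tests (`Z ∈ DD*`, symmetry, `⟨J,Z⟩ ≥ 0`, `⟨S,Z⟩ < 0`) and the size caps.  Soundness in the
sequel `IntegerScrewCensusDualSound`.  Pure arithmetic; RH-free; nothing here bears on the truth of RH.
-/

set_option linter.dupNamespace false
set_option autoImplicit false

namespace Summit.RiemannHypothesis.RiemannHypothesis.Theorems.IntegerScrew.Manifest.Fast

open Literature.Analysis.ValidatedNumerics Literature.Analysis.ValidatedNumerics.Numerics
open Literature.Analysis.ValidatedNumerics.KroneckerDot

/-! ### Per-cell accumulators (signed) -/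

/-- The stored integers `(x, y) = (X − OFF, Y − OFF)` of a node value (`≈ 2^52 (cos, sin)`). -/
def xyOf (v : ℕ × ℕ) : ℤ × ℤ := (oval v.1, oval v.2)

/-- Inner sums of one sparse lower row against the cell's node integers: `(Σ_b Ω_ab x_b, Σ_b Ω_ab y_b)`. -/
def innerSums : List (ℕ × ℤ) → List (ℤ × ℤ) → ℤ × ℤ
  | [], _ => (0, 0)
  | (gap, o) :: rest, xys =>
    match xys.drop gap with
    | [] => (0, 0)
    | (x, y) :: tail =>
      let r := innerSums rest tail
      (r.1 + o * x, r.2 + o * y)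

/-- The cell accumulators, Kronecker-packed over the Taylor order with SIGNED virtual digits:
`txx = Σ_a x_a Σ_{b<a} Ω_ab x_b`, `tyy`, `tyx = Σ_a y_a Σ_b Ω_ab x_b`, `txy = Σ_a x_a Σ_b Ω_ab y_b`, and the node sums
`nx = Σ_a Ω_a x_a`, `ny = Σ_a Ω_a y_a`. -/
@[ext] structure CellAcc where
  /-- `Σ_a x_a IX_a` -/
  txx : ℤ
  /-- `Σ_a y_a IY_a` -/
  tyy : ℤ
  /-- `Σ_a y_a IX_a` -/
  tyx : ℤ
  /-- `Σ_a x_a IY_a` -/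
  txy : ℤ
  /-- `Σ_a Ω_a x_a` -/
  nx : ℤ
  /-- `Σ_a Ω_a y_a` -/
  ny : ℤ

/-- Accumulate over the nodes (node data zipped with the cell's node integers; `xys0` = the full list). -/
def accNodes (xys0 : List (ℤ × ℤ)) : List NodeD → List (ℤ × ℤ) → CellAcc
  | nd :: nds, (x, y) :: rest =>
    let r := accNodes xys0 nds rest
    let i := innerSums nd.low xys0
    ⟨r.txx + x * i.1, r.tyy + y * i.2, r.tyx + y * i.1, r.txy + x * i.2, r.nx + nd.nom * x, r.ny + nd.nom * y⟩
  | _, _ => ⟨0, 0, 0, 0, 0, 0⟩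

/-! ### Slots and the Taylor coefficients -/

/-- Slot `k` of a packed natural (base `2^SW`). -/
def slotAt (N k : ℕ) : ℕ := Nat.land (Nat.shiftRight N (SW * k)) (SWB - 1)

/-- The balanced offset `Σ_{k≤D} 2^{SW−1}·2^{SW k}` (makes all virtual digits nonnegative before extraction). -/
def halfPack (D : ℕ) : ℕ := packN SWB ((List.range (D + 1)).map fun _ => 2 ^ (SW - 1))

/-- Signed slot `k` of an integer with balanced virtual digits: `slotAt (N + halfPack) k − 2^{SW−1}`. -/
def slotZ (H : ℕ) (N : ℤ) (k : ℕ) : ℤ := ((slotAt (N + H).toNat k : ℕ) : ℤ) - ((2 ^ (SW - 1) : ℕ) : ℤ)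

/-- The integer Taylor coefficient `G_k = Re(i^k · (RE_k + i·IM_k))` from the signed slots of
`RE = txx + tyy + nx` (`Σ_f A_f W_{f,k}·2^104 Re ζ̂_f`) and `IM = tyx − txy + ny` (`Σ_f A_f W_{f,k}·2^104 Im ζ̂_f`):
`Re, −Im, −Re, Im` for `k mod 4 = 0, 1, 2, 3`. -/
def gAt (H : ℕ) (acc : CellAcc) (k : ℕ) : ℤ :=
  let re := slotZ H (acc.txx + acc.tyy + acc.nx) k
  let im := slotZ H (acc.tyx - acc.txy + acc.ny) k
  if k % 4 = 0 then re else if k % 4 = 1 then -im else if k % 4 = 2 then -re else im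

/-- The coefficient list `[G_0 + c, G_1, …, G_D]` (`c` = the constant `C0·K0` of the model). -/
def gList (D H : ℕ) (acc : CellAcc) (c : ℤ) : List ℤ :=
  (List.range (D + 1)).map fun k => if k = 0 then gAt H acc 0 + c else gAt H acc k

/-! ### Change of variable `σ = 2τ − 1` and the Horner form -/

/-- Tail of `p·(2τ−1)`: `[2p₀ − p₁, 2p₁ − p₂, …, 2p_last]`. -/
def mulLinTail : List ℤ → List ℤ
  | [] => []
  | [x] => [2 * x]
  | x :: y :: rest => (2 * x - y) :: mulLinTail (y :: rest)

/-- `p·(2τ − 1) + g` on coefficient lists (low degree first). -/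
def mulLinAdd (g : ℤ) : List ℤ → List ℤ
  | [] => [g]
  | p0 :: ps => (g - p0) :: mulLinTail (p0 :: ps)

/-- `H(τ) = P(2τ − 1)` for `P = Σ_k g_k σ^k` (Horner composition from the top coefficient). -/
def tauPoly (gs : List ℤ) : List ℤ := gs.foldr mulLinAdd []

/-- Formal derivative of a coefficient list (low degree first): `(c + x·p)′ = p + x·p′`. -/
def derivZ : List ℤ → List ℤ
  | [] => []
  | _ :: cs => addZ cs (0 :: derivZ cs)

/-- The least nonnegative `C` with `c_k + C ≥ 0` for all `k`. -/
def negFloor : List ℤ → ℕ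
  | [] => 0
  | c :: cs => max (-c).toNat (negFloor cs)

/-- Shifted nonnegative Horner coefficients `(c_k + C)·2^{R(D−k)}` (low degree first), `k = 0 … D`. -/
def prepGo (C D : ℕ) : ℕ → List ℤ → List ℕ
  | _, [] => []
  | k, c :: cs => Nat.shiftLeft (c + C).toNat (RB * (D - k)) :: prepGo C D (k + 1) cs

/-- Pad/truncate a coefficient list to length `D + 1`. -/
def padTo (D : ℕ) (cs : List ℤ) : List ℤ := (List.range (D + 1)).map fun k => cs.getD k 0

/-- Horner evaluation `Σ_k c_k m^k` (coefficients low degree first). -/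
def hornerR (m : ℕ) : List ℕ → ℕ
  | [] => 0
  | c :: cs => Nat.add c (Nat.mul m (hornerR m cs))

/-- `Σ_{k=0}^{D} m^k M^{D−k} = (M^{D+1} − m^{D+1})/(M − m)` for `m < M = 2^R`. -/
def geoSum (D m : ℕ) : ℕ := (MR ^ (D + 1) - m ^ (D + 1)) / (MR - m)

/-! ### The walk -/

/-- The step search: the largest step `2^{R−r}`, `r` from the list, that stays inside the cell and passes the test
`2·8^r·A0 ≥ 2·4^r·B1 + 2^r·B2 + 2Λ`. -/
def stepFind (A0 B1 B2 Lam m mend : ℕ) : List ℕ → Option ℕ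
  | [] => none
  | r :: rs =>
    if m + 2 ^ (RB - r) ≤ mend ∧ 2 * 4 ^ r * B1 + 2 ^ r * B2 + 2 * Lam ≤ 2 * 8 ^ r * A0 then some (2 ^ (RB - r))
    else stepFind A0 B1 B2 Lam m mend rs

/-- The step menu `r = 4 … R` (step `2^{R−r}` of the cell, i.e. at most `1/16`). -/
def rMenu : List ℕ := (List.range (RB - 3)).map fun i => i + 4

/-- The adaptive walk from `m` to `mend` (fuel-bounded): at each point the three Horner values, the offsets
`C·geo(m)`, the test quantities `A0 = H − S0`, `B1 = (S1 − H′)⁺`, `B2 = (S2 − H″)⁺`, and a step. -/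
def walkGo (c0 c1 c2 : List ℕ) (C0 C1 C2 S0 S1 S2 Lam D mend : ℕ) : ℕ → ℕ → Bool
  | 0, m => decide (mend ≤ m)
  | fuel + 1, m =>
    if mend ≤ m then true else
      let g := geoSum D m
      let h0 := hornerR m c0
      let T0 := Nat.add (Nat.mul C0 g) S0
      if h0 < T0 then false else
        let A0 := Nat.sub h0 T0
        let B1 := Nat.sub (Nat.add S1 (Nat.mul C1 g)) (hornerR m c1)
        let B2 := Nat.sub (Nat.add S2 (Nat.mul C2 g)) (hornerR m c2)
        match stepFind A0 B1 B2 Lam m mend rMenu with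
        | none => false
        | some st => walkGo c0 c1 c2 C0 C1 C2 S0 S1 S2 Lam D mend fuel (m + st)

/-! ### Slacks -/

/-- `K0 = 2^{104+E}·D!` (the scale of the model). -/
def K0N (D E : ℕ) : ℕ := 2 ^ (104 + E) * Nat.factorial D

/-- The three slacks `(S0, S1, S2)` (scaled by `2^{RD}`) of a cell with error-unit numerator `Un = 32·j·Wmax + 7000`
(`U = Un/(500·2^52)`, `δ = 31U`), `C1N = 2^52·c₁` (`c₁ = h·f_max + 2^{-46}`, `h = 2`), `ΣA = Σ_f |A_f|`:
with `ρ ≤ rho60/2^60`, `δ ≤ del60/2^60` (units `2^{-60}`),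
`S0 ≥ 2^{RD}(K0 ΣA (δ(1+ρ) + ρ + 2^{-46}) + (D+1)2^105 ΣA)`, `S1 ≥ 2^{RD}·2·(K0 ΣA (c₁(δ(1+ρ)+ρ) + 2^{-46}(1+c₁)) + (D+1)²2^105 ΣA)`,
`S2 ≥ 2^{RD}·4·(K0 ΣA (c₁²(δ(1+ρ)+ρ) + 2^{-46}(2c₁+c₁²)) + (D+1)³2^105 ΣA)`. -/
def slacks (D E Un C1N sumA : ℕ) : ℕ × ℕ × ℕ :=
  let K0 := K0N D E
  let rho60 := 2 * C1N ^ (D - 1) * 2 ^ 60 / (2 ^ (52 * (D - 1)) * Nat.factorial (D - 1)) + 1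
  let del60 := 31 * Un * 2 ^ 8 / 500 + 1
  let dr := del60 * (2 ^ 60 + rho60) / 2 ^ 60 + 1 + rho60            -- ≥ 2^60 (δ(1+ρ) + ρ)
  let b0 := dr + 2 ^ 14                                                 -- + 2^-46
  let b1 := C1N * dr / 2 ^ 52 + 1 + 2 ^ 14 * (2 ^ 52 + C1N) / 2 ^ 52 + 1
  let b2 := C1N * C1N * dr / 2 ^ 104 + 1 + 2 ^ 14 * (2 * C1N * 2 ^ 52 + C1N * C1N) / 2 ^ 104 + 1
  let fl := 2 ^ 105 * sumA
  (2 ^ (RB * D) * (K0 * sumA * b0 / 2 ^ 60 + 1 + (D + 1) * fl),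
    2 ^ (RB * D) * 2 * (K0 * sumA * b1 / 2 ^ 60 + 1 + (D + 1) ^ 2 * fl),
    2 ^ (RB * D) * 4 * (K0 * sumA * b2 / 2 ^ 60 + 1 + (D + 1) ^ 3 * fl))

/-- The cubic coefficient `Λ ≥ 2^{RD}·K0·(64/3)·Σ_f |A_f| f³` (`h = 2`; `amp3 = Σ |A_f| (φ_f+32)³`, units `2^{-156}`). -/
def lamOf (D E amp3 : ℕ) : ℕ := 2 ^ (RB * D) * K0N D E * 64 * amp3 / (3 * 2 ^ 156) + 1

/-! ### The checker -/

/-- One cell: node integers from the rows at the single atom `j`, accumulators, Taylor coefficients, `τ`-form, walk. -/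
def cellCheck (D HP : ℕ) (nds : List NodeD) (c0K : ℤ) (S : ℕ × ℕ × ℕ) (Lam : ℕ)
    (vals : List (ℕ × ℕ)) (mstart mend fuel : ℕ) : Bool :=
  let xys := vals.map xyOf
  let acc := accNodes xys nds xys
  let H := tauPoly (gList D HP acc c0K)
  let H1 := padTo D (derivZ H)
  let H2 := padTo D (derivZ (derivZ H))
  let C0 := negFloor H
  let C1 := negFloor H1
  let C2 := negFloor H2
  walkGo (prepGo C0 D 0 H) (prepGo C1 D 0 H1) (prepGo C2 D 0 H2) C0 C1 C2 S.1 S.2.1 S.2.2 Lam D mend fuel mstart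

/-- The cells `c = cFrom … cTo − 1` of `[0, lo]` (cell `c` = `[4c, 4c+4]`, atom `j = 2000c + 1000`; the walk starts at
`τ = ⌊2^R/40⌋/2^R ≤ 1/40` in cell `0` (`t ≤ 1/10`) and ends at `t = lo`). -/
def cellsGo (D E n lo Wmax fuel : ℕ) (logs : List FI) (nds : List NodeD) (c0K : ℤ)
    (C1N sumA Lam : ℕ) : ℕ → ℕ → Bool
  | 0, _ => true
  | k + 1, c =>
    let j := 2000 * c + 1000
    let R := rows tcList logs 500 [j] n
    let vals := (R.1.drop 2).map fun dr => dr.2.getD 0 (0, 0)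
    let S := slacks D E (32 * j * Wmax + 7000) C1N sumA
    let mstart := if c = 0 then MR / 40 else 0
    let mend := if 4 * c + 4 ≤ lo then MR else MR * (lo - 4 * c) / 4
    R.2 && cellCheck D (halfPack D) nds c0K S Lam vals mstart mend fuel &&
      cellsGo D E n lo Wmax fuel logs nds c0K C1N sumA Lam k (c + 1)

/-- The node `φ`'s: `φ_a = 16·L_{a+2}` (`L` = lower end of the log enclosure, scale `2^48`; `φ/2^52 ≈ log(a+2)`). -/
def phis (logs : List FI) (n : ℕ) : List ℕ := (List.range n).map fun a => 16 * (logLoW logs (a + 2)).1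

/-- **THE DUAL CHECKER** (heavy part) on the cells `cFrom ≤ c < cTo`: pattern literal `pats` (triples `(m, signbits, 2^60 y)`),
`epsN = 2^60 ε`, log table `logs`, Taylor order `D`, extra bits `E`, walk fuel. -/
def dualCheck (n lo D E fuel cFrom cTo : ℕ) (logs : List FI) (pats : List (ℕ × ℕ × ℕ)) (epsN : ℕ) : Bool :=
  let Z := zMatrix n epsN pats
  let φs := phis logs n
  let cs := kConsts D E
  let nds := nodeData cs Z φs
  let amps := ampSums Z φs
  let Wmax := maxLogWidth logs (n + 1)
  let φmax := 16 * ((logLoW logs (n + 1)).1 + Wmax)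
  let C1N := 2 * φmax + 64
  let c0K : ℤ := constQ Z * (K0N D E : ℕ)
  let Lam := lamOf D E amps.2
  cellsGo D E n lo Wmax fuel logs nds c0K C1N amps.1 Lam (cTo - cFrom) cFrom

/-- **THE LIGHT TEST**: sizes and caps (`1 ≤ n ≤ 112`, log widths, `2·C1N ≤ D·2^52` for the Taylor remainder,
`15·U_max ≤ 1`, `lo ≥ 1`), `Z` symmetric of size `n`, `Z ∈ DD*`, `⟨J, Z⟩ ≥ 0`, and `2^164⟨S, Z⟩ < 0` by the u-table digits. -/
def dualLight (n lo D : ℕ) (logs : List FI) (utab : List (List (ℕ × ℕ))) (pats : List (ℕ × ℕ × ℕ)) (epsN CL CH : ℕ) :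
    Bool :=
  let Z := zMatrix n epsN pats
  let Wmax := maxLogWidth logs (n + 1)
  let φs := phis logs n
  let φmax := 16 * ((logLoW logs (n + 1)).1 + Wmax)
  let C1N := 2 * φmax + 64
  let jmax := 2000 * ((lo + 3) / 4) + 1000
  decide (1 ≤ n) && decide (n + 1 ≤ 113) && decide (1 ≤ lo) && decide (4 ≤ D) && decide (Wmax ≤ 2 ^ 20) &&
    decide (2 * C1N ≤ D * 2 ^ 52) && decide (C1N ≤ 2 ^ 56) && decide ((32 * jmax * Wmax + 7000) * 26 ≤ SCL * 500) &&
    decide (CL ≤ CH) && decide (n + 2 ≤ utab.length) &&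
    (pats.all fun p => decide (p.1 < n)) &&
    ((List.range n).all fun a => decide (φs.getD a 0 ≤ φmax) &&
      (List.range a).all fun b => decide (φs.getD b 0 ≤ φs.getD a 0)) &&
    symmCheck Z && decide (Z.length = n) && ddDualCheck Z && decide (0 ≤ onesPair Z) &&
    decide (maxAbsZ Z ≤ 2 ^ 62) && ((wDigits φmax (kConsts D EB) 1).all fun w => decide (w < 2 ^ 236)) &&
    decide (sPairUpper CL CH Z ((utab.drop 2).take n) [] 0 < 0)

end Summit.RiemannHypothesis.RiemannHypothesis.Theorems.IntegerScrew.Manifest.Fast
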